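import Literature.AlgebraicGeometry.Frobenioids.Thm49Compat
import Literature.AlgebraicGeometry.Frobenioids.Thm49SufficesRightEqLeftProofsWeak
import HarnessLib

/-!
# [FrdI] Theorem 4.9 WITH its compatibility clause, from row T49-L02, in the WEAK setting

Mochizuki, *The geometry of Frobenioids I: the general theory*, Kyushu J. Math. **62** (2008)
293–400, §4, Theorem 4.9, statement p. 88 l. 33 – p. 89 l. 2 ("compatible [when the `C_i` are of isotropic,
but not of group-like type] with the isomorphism `Ψ^Prime`"), proof p. 89 ll. 6–36
[cite: MochizukiFrdI2008, Thm. 4.9 p.89].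

PROOF-ONLY file (cell abc-iut, layer L1, seat abc-iut-L1-t14; row «C411iii/iv-WEAK» = the [FrdI] Thm. 4.9 /
Cor. 4.11 (iii)(iv) chain over `IsPerfFactorialWeak`, block (T3)). WEAK-HYPOTHESIS TWINS of the two
`T42.Setting`-typed theorems of `Thm49Compat.lean` (seat abc-iut-L1-t3), now over `FrdI.T42.SettingWeak`
(`Thm42SubWeak.lean`; "`Φ_i` perf-factorial" weakened to "`Φ_i` weakly perf-factorial", Def. 2.4 (i) (a)(b)(c) +
(d_ord) + (d_res); cell finding F-L2d2-1): `FrdI.T49.exists_thm49_compat_of_sufficesRightEqLeft_weak` — where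
the strong theorem takes row T49-L02 `SufficesRightEqLeft` as a hypothesis `h`, the weak twin consumes its
PROOF over the weak setting, `sufficesRightEqLeft_holds_weak` (`Thm49SufficesRightEqLeftProofsWeak.lean`), so
the binder `h` and the two binders of the row that its proof does not use disappear — and
`FrdI.T49.invDiv_map_mem_carrier_of_clauseB_weak`. The hypothesis-free `mem_primesSubmonoid_iff_of_divClause` /
`thm49_compat_of_divClause` are consumed BY NAME. No new definitions; nothing of the paper restated or
strengthened; nothing here is specific to the abc programme and no side is taken on [IUTchIII] Cor. 3.12.
-/

namespace Literature.AlgebraicGeometry.Frobenioids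

open CategoryTheory Opposite

namespace FrdI.T49

universe w v v' u u'

variable {D₁ : Type u} [Category.{v} D₁] {Φ₁ : D₁ᵒᵖ ⥤ CommMonCat.{w}} {C₁ : Type u'} [Category.{v'} C₁]
  {D₂ : Type u} [Category.{v} D₂] {Φ₂ : D₂ᵒᵖ ⥤ CommMonCat.{w}} {C₂ : Type u'} [Category.{v'} C₂]

/-- (WEAK setting; twin of `exists_thm49_compat_of_sufficesRightEqLeft`, with row T49-L02 consumed as the proved
`sufficesRightEqLeft_holds_weak` instead of a hypothesis.) **Thm. 4.9, existence WITH the compatibility clause from row T49-L02** (p. 89 ll. 6–36 and ll. 1–2):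
in a `T42.SettingWeak` (perfect, isotropic type; `Ψ`, `Ψ⁻¹` preserving primary pre-steps), given a family
`e = Ψ^Prime` with clause (a) of Thm. 4.2 (ii) and the carrier clause, and the coincidence of the right-hand
and left-hand isomorphisms of Thm. 4.2 (iii) at all universally Div-Frobenius-trivial objects, row T49-L02
`SufficesRightEqLeft` (hypothesis) produces an isomorphism of functors `Ψ^Φ : Φ₁ ⥲ Φ₂` over `Ψ` — the closing
shape of the typed `Thm49` — computing `Div(Ψ φ) = Ψ^Φ_A(Div φ)` on all pre-steps and satisfying the typed
compatibility clause `Thm49_compat` with respect to `e`. [cite: MochizukiFrdI2008, Thm. 4.9 p.89] -/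
theorem exists_thm49_compat_of_sufficesRightEqLeft_weak
    (F₁ : C₁ ⥤ ElemFrobenioid Φ₁) (F₂ : C₂ ⥤ ElemFrobenioid Φ₂) (Ψ : C₁ ≌ C₂) (S : T42.SettingWeak F₁ F₂ Ψ)
    (e : ∀ A : C₁, Primes (Φ₁.obj (op (PreFrobenioid.baseObj F₁ A))) ≃
      Primes (Φ₂.obj (op (PreFrobenioid.baseObj F₂ (Ψ.functor.obj A)))))
    (he : ∀ (A : C₁) (𝔭 : Primes (Φ₁.obj (op (PreFrobenioid.baseObj F₁ A)))) ⦃B : C₁⦄ (φ : A ⟶ B),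
      PreFrobenioid.IsCoAngularPreStep F₁ φ →
        (PreFrobenioid.Div F₁ φ ∈ 𝔭.submonoid ↔
          PreFrobenioid.Div F₂ (Ψ.functor.map φ) ∈ (e A 𝔭).submonoid))
    (hRL : ∀ (A : C₁), PreFrobenioid.IsUniversallyDivFrobeniusTrivial F₁ A →
      ∀ 𝔭 : Primes (Φ₁.obj (op (PreFrobenioid.baseObj F₁ A))), RightEqLeftAt F₁ F₂ Ψ A 𝔭 (e A 𝔭)) :
    ∃ E : PreFrobenioidData.DivisorMonoidIsoOver (PreFrobenioidData.ofFunctor Φ₁ F₁)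
        (PreFrobenioidData.ofFunctor Φ₂ F₂) Ψ,
      (∀ ⦃A B : C₁⦄ (φ : A ⟶ B), PreFrobenioid.IsPreStep F₁ φ →
          E.iso A (PreFrobenioid.Div F₁ φ) = PreFrobenioid.Div F₂ (Ψ.functor.map φ)) ∧
      Literature.AlgebraicGeometry.Frobenioids.PreFrobenioidData.Thm49_compat
        (PreFrobenioidData.ofFunctor Φ₁ F₁) (PreFrobenioidData.ofFunctor Φ₂ F₂) Ψ E e := by
  obtain ⟨m, hdiv, hnat⟩ := sufficesRightEqLeft_holds_weak S e hRL
  refine ⟨⟨m, fun A B φ x => hnat φ x⟩, hdiv, ?_⟩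
  exact thm49_compat_of_divClause F₁ F₂ Ψ S.isFrobenioid₁ _ e he fun _ _ φ hφ => hdiv φ hφ.2

/-- (WEAK setting; twin of `invDiv_map_mem_carrier_of_clauseB`.) **The "carrier" clause of row T49-L02 from clause (b) of Thm. 4.2 (ii)** (p. 80 ll. 18–33: primes as
classes of primary steps INTO `A`): in a `T42.SettingWeak`, if `e = Ψ^Prime` satisfies clause (b) at `(A, 𝔭)`
("`(ψ^*)⁻¹Div ψ ∈ Φ₁(A)_𝔭 ⟺ ((Ψψ)^*)⁻¹Div(Ψ ψ) ∈ Φ₂(Ψ A)_{e(𝔭)}` for co-angular pre-steps `ψ` into `A`"),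
then for every primary pre-step `ε : E → A` with `(ε^*)⁻¹Div ε ∈ 𝔭` the element `((Ψε)^*)⁻¹Div(Ψ ε)` lies in
the prime `e(𝔭)` itself (not merely in the submonoid it generates): it is `≠ 1` because `Ψ ε` is a step.
[cite: MochizukiFrdI2008, Thm. 4.2 (ii) p.80] -/
theorem invDiv_map_mem_carrier_of_clauseB_weak (F₁ : C₁ ⥤ ElemFrobenioid Φ₁) (F₂ : C₂ ⥤ ElemFrobenioid Φ₂)
    (Ψ : C₁ ≌ C₂) (S : T42.SettingWeak F₁ F₂ Ψ)
    (e : ∀ A : C₁, Primes (Φ₁.obj (op (PreFrobenioid.baseObj F₁ A))) ≃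
      Primes (Φ₂.obj (op (PreFrobenioid.baseObj F₂ (Ψ.functor.obj A)))))
    (hb : ∀ (A : C₁) (𝔭 : Primes (Φ₁.obj (op (PreFrobenioid.baseObj F₁ A)))) ⦃B : C₁⦄ (ψ : B ⟶ A),
      PreFrobenioid.IsCoAngularPreStep F₁ ψ →
        ((∃ y ∈ 𝔭.submonoid, pull Φ₁ (PreFrobenioid.Base F₁ ψ) y = PreFrobenioid.Div F₁ ψ) ↔
          ∃ y ∈ (e A 𝔭).submonoid, pull Φ₂ (PreFrobenioid.Base F₂ (Ψ.functor.map ψ)) y =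
            PreFrobenioid.Div F₂ (Ψ.functor.map ψ)))
    (A : C₁) ⦃E : C₁⦄ (ε : E ⟶ A) (hε : PreFrobenioid.IsPrimaryPreStep F₁ ε)
    (𝔭 : Primes (Φ₁.obj (op (PreFrobenioid.baseObj F₁ A))))
    (h𝔭 : PreFrobenioid.invDiv F₁ ε hε.1.2 ∈ 𝔭.carrier)
    (h₂ : PreFrobenioid.IsBaseIso F₂ (Ψ.functor.map ε)) :
    PreFrobenioid.invDiv F₂ (Ψ.functor.map ε) h₂ ∈ (e A 𝔭).carrier := by
  have hco : PreFrobenioid.IsCoAngular F₁ ε :=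
    PreFrobenioid.isCoAngular_of_isIsotropic_codomains F₁ ε fun Z _ => S.isotropic₁ Z
  obtain ⟨y, hy, hyx⟩ := (hb A 𝔭 ε ⟨hco, hε.1⟩).mp
    ⟨_, Submonoid.subset_closure h𝔭, PreFrobenioid.pull_invDiv ε hε.1.2⟩
  haveI : IsIso (PreFrobenioid.Base F₂ (Ψ.functor.map ε)) := h₂
  have hy' : y = PreFrobenioid.invDiv F₂ (Ψ.functor.map ε) h₂ :=
    pull_injective_of_isIso Φ₂ (PreFrobenioid.Base F₂ (Ψ.functor.map ε))
      (by rw [hyx, PreFrobenioid.pull_invDiv])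
  rcases ((e A 𝔭).mem_submonoid_iff' y).mp hy with h1 | h1
  · exact absurd (by rw [← hyx, h1, map_one]) (PreFrobenioid.div_ne_one_of_isStep S.isotropic₂
      (S.step_map ε (PreFrobenioid.IsPrimaryPreStep.isStep S.isFrobenioid₁.isPreFrobenioid hε)))
  · exact hy' ▸ h1

end FrdI.T49

end Literature.AlgebraicGeometry.Frobenioids
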